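import Summits.BirchSwinnertonDyer.BirchSwinnertonDyer.Theorems.ClassRecordThreeCornerAtThreeUpperShimuraAnchorDefs
import Summits.BirchSwinnertonDyer.BirchSwinnertonDyer.Theorems.ErratumRoadFiveNonSurjCornerTamagawaCarriersAnyPrime
import Summits.BirchSwinnertonDyer.Rank1Residual.X11b.BDPRouteTamagawaSupport
import Summits.BirchSwinnertonDyer.Rank1Residual.X11b.TamagawaLocalLemmas
import HarnessLib

/-!
# Crux `CornerAtThreeW` (item stmt-BirchSwinnertonDyer-21420), conjunct (U): the `3`-ANCHOR admissibility — §3 of 3: THE SHAPE OF THE IMC-GRADE TAIL —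
# every multi-carrier (T4″)₃ corner curve with the Tamagawa shape (every `3`-carrier split multiplicative) is admissible-anchor as it stands or up to one exempted
# place; the IMC-grade input of (U) is left ONLY on the multi-carrier corner curves with an ADDITIVE `3`-carrier (Kodaira IV ∕ IV*, `c_q = 3`)
# (cell `bsd-stepL`, seat `bsd-stepL-corner3-p2` g12 = WIDTH-LEVER lane B; `--supports stmt-BirchSwinnertonDyer-21420 --as helper`)

WHAT. `Three.exists_splitOffender_ne_three_of_multiCarrier_of_shape` (multi-carrier ∧ shape ⟹ a split multiplicative `ℓ ≠ 3` with `3 ∣ ord_ℓ Δ_min`: two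
`3`-carriers by lane B's carrier dictionary `CornerLocal.forall_padicValNat_tamagawaNumberAt_lt_iff_exists_two_dvd`, read at the prime under the place by
`localTamagawaNumber_padic_eq_holds`, split multiplicative by the shape, `c_ℓ = ord_ℓ Δ_min` by `X11b.localTamagawaNumber_eq_padicValInt_of_split`);
`Three.cornerInertAdmissibleAnchor_or_upToOne_of_multiCarrier_of_shape` — THE TAIL LEMMA (finite-set bookkeeping: `Off` = split offenders `≠ 3`; `S = {3} ∪ Off`
if `#Off` odd; `S = {3, m} ∪ Off` with a spare multiplicative `m`; else exempt one offender — the up-to-one road, the ONLY consumer of the line's (B6) label);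
`Three.cornerTailAnchor_shape` — contrapositive: admissible-anchor NEITHER way ⟹ some prime with `3 ∣ c_q(E)` is NOT split multiplicative. So after r14 the
IMC-grade input of (U) is consumed ONLY on multi-carrier corner curves with an additive IV ∕ IV* `3`-carrier (census 0 of 296 below `5·10⁵`, lane B g6; class-wide
non-empty; no Shimura frame puts a tame additive prime in `N⁻` with the right sign — tam3-p1 g17's Tunnell–Saito note). The «three split offenders ≡ 1 (mod 3)»
family of the half-based residual (`Three.cornerTail₂_shape` of the superseded (DEG₂) cut) is GONE.

HONEST FRAMING: THEOREMS ONLY (finite-set bookkeeping + the cell's Tamagawa-carrier dictionary; no definition, no named fact, no `sorry`); nothing about any L-value, Selmer group or Heegner point is proved here; nothing here is a BSD class theorem; no census label moves (T7); 21420 ∕ 19111 NOT closed; BSD is proved for no curve. Credit: idea-crit-14 ∕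
bsd-idea-9 g4 (the anchor), LEAD er5-p1 g1 and w2 g0–g2 (the telescopes, Lemma 6.18 in full), corner-p1 g17 (p-anchor inert ∕ saved cores), lane B g3–g12
(cores, glue, carrier dictionary), x11b3, tam3-p1, shim seats.
References (locators only): [cite: PastenShimura2024, §6.6, Prop. 6.13, Lemmas 6.15, 6.16 and 6.18 (arXiv v4 pp. 30–33)] [cite: PapikianRabinoff2016, Cor. 3.5]
[cite: RibetTakahashi1997, Thm. 1] [cite: Jetchev2008, Thm. 1.1, Cor. 1.5] [cite: JetchevSkinnerWan2017, §7.4.2 (pp. 30–31)] [cite: CaiShuTian2014, Thm. 1.5]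
[cite: SilvermanATAEC1994, Cor. IV.9.2 (d) and Table 4.1] [cite: SilvermanAEC2009, C.16].
-/

set_option autoImplicit false
set_option linter.dupNamespace false -- `Summit.BirchSwinnertonDyer.BirchSwinnertonDyer` (summit = problem), tree-wide

noncomputable section

open scoped Classical NumberField

open WeierstrassCurve NumberField IsDedekindDomain CongruenceSubgroup Literature.NumberTheory.EllipticCurves
  Literature.NumberTheory.EllipticCurves.ModularForms Literature.NumberTheory.Automorphic
  Literature.NumberTheory.EllipticCurves.Rank1Residual Literature.NumberTheory.EllipticCurves.Rank1Residual.Typed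
  Literature.NumberTheory.EllipticCurves.BarriosEtAl2025
  Summit.BirchSwinnertonDyer.Rank1Residual Summit.BirchSwinnertonDyer.Rank1Residual.X11b

namespace Summit.BirchSwinnertonDyer.BirchSwinnertonDyer.Theorems

/-! ### §4. THE TAIL: multi-carrier ∧ Tamagawa shape ⟹ admissible-anchor (as it stands or up to one place) -/

/-- **An offending split carrier `≠ 3` on a multi-carrier corner curve with the Tamagawa SHAPE.** Multi-carrier (`∀ v, ord₃ c_v < ord₃ ∏c`) gives two distinct
places with `3 ∣ c_v` (lane B's `CornerLocal.forall_padicValNat_tamagawaNumberAt_lt_iff_exists_two_dvd`); read at the prime under a place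
(`localTamagawaNumber_padic_eq_holds`) the shape makes each split multiplicative, and `c_ℓ = ord_ℓ Δ_min` there (`X11b.localTamagawaNumber_eq_padicValInt_of_split`);
two distinct primes are not both `3`. [cite: SilvermanAEC2009, C.16] [cite: SilvermanATAEC1994, Cor. IV.9.2 (d)] -/
theorem Three.exists_splitOffender_ne_three_of_multiCarrier_of_shape (W : WeierstrassCurve ℚ) [W.IsElliptic] [W.IsGloballyMinimal]
    (hmulti : ∀ v : HeightOneSpectrum (𝓞 ℚ), padicValNat 3 (W.tamagawaNumberAt v) < padicValNat 3 W.tamagawaProduct)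
    (hshape : ∀ (q : ℕ) [Fact q.Prime], 3 ∣ (W.baseChange ℚ_[q]).localTamagawaNumber ℤ_[q] →
      W.HasSplitMultiplicativeReductionAtPrime q) :
    ∃ (ℓ : ℕ) (_ : Fact ℓ.Prime), ℓ ≠ 3 ∧ W.HasSplitMultiplicativeReductionAtPrime ℓ ∧
      3 ∣ padicValInt ℓ W.minimalDiscriminantInt := by
  haveI : Fact (Nat.Prime 3) := ⟨Nat.prime_three⟩
  obtain ⟨v₁, v₂, hne, hd₁, hd₂⟩ :=
    (CornerLocal.forall_padicValNat_tamagawaNumberAt_lt_iff_exists_two_dvd W 3).mp hmulti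
  -- the prime under a place, the shape read at it, and the offending exponent
  have key : ∀ v : HeightOneSpectrum (𝓞 ℚ), 3 ∣ W.tamagawaNumberAt v →
      ∃ (ℓ : ℕ) (_ : Fact ℓ.Prime), (Rat.HeightOneSpectrum.primesEquiv v : ℕ) = ℓ ∧
        W.HasSplitMultiplicativeReductionAtPrime ℓ ∧ 3 ∣ padicValInt ℓ W.minimalDiscriminantInt := by
    intro v hv
    haveI hF : Fact (Rat.HeightOneSpectrum.primesEquiv v : ℕ).Prime := ⟨(Rat.HeightOneSpectrum.primesEquiv v).2⟩
    have hc : 3 ∣ (W.baseChange ℚ_[(Rat.HeightOneSpectrum.primesEquiv v : ℕ)]).localTamagawaNumber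
        ℤ_[(Rat.HeightOneSpectrum.primesEquiv v : ℕ)] := by
      rw [localTamagawaNumber_padic_eq_holds W v _ rfl]
      exact hv
    have hs := hshape _ hc
    -- `c_ℓ = ord_ℓ Δ_min` at the split multiplicative prime (read at the `ℤ`-place under `ℓ`)
    set w : HeightOneSpectrum ℤ := Rat.HeightOneSpectrum.primesEquiv.symm (Rat.HeightOneSpectrum.primesEquiv v) with hw
    have hwℓ : (Rat.HeightOneSpectrum.primesEquiv w : ℕ) = (Rat.HeightOneSpectrum.primesEquiv v : ℕ) := by
      rw [hw, Equiv.apply_symm_apply]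
    refine ⟨Rat.HeightOneSpectrum.primesEquiv v, hF, rfl, hs, ?_⟩
    rw [← X11b.localTamagawaNumber_eq_padicValInt_of_split W w hwℓ hs]
    exact hc
  obtain ⟨ℓ₁, hF₁, hv₁, hs₁, hdv₁⟩ := key v₁ hd₁
  obtain ⟨ℓ₂, hF₂, hv₂, hs₂, hdv₂⟩ := key v₂ hd₂
  have hℓ : ℓ₁ ≠ ℓ₂ := by
    rintro h
    apply hne
    apply Rat.HeightOneSpectrum.primesEquiv.injective
    exact Subtype.ext (hv₁.trans (h.trans hv₂.symm))
  by_cases h₁ : ℓ₁ = 3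
  · refine ⟨ℓ₂, hF₂, ?_, hs₂, hdv₂⟩
    rintro rfl
    exact hℓ h₁
  · exact ⟨ℓ₁, hF₁, h₁, hs₁, hdv₁⟩

/-- **THE TAIL LEMMA: every multi-carrier (T4″)₃ corner curve with the Tamagawa SHAPE is admissible-anchor, as it stands or up to one exempted place.**
`Off` := the split multiplicative `q ≠ 3` with `3 ∣ ord_q Δ_min` (non-empty by the previous lemma). If `#Off` is odd, `S = {3} ∪ Off` (anchor `3`); if `#Off` is even
and a multiplicative prime `m ∉ Off ∪ {3}` exists, `S = {3, m} ∪ Off`; otherwise exempt one offender `q₁`: `S = {3} ∪ Off ∖ {q₁}` (the up-to-one road — the ONLY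
place where the (B6) label of the line is consumed). Finite-set bookkeeping; nothing asserted about BSD.
[cite: PastenShimura2024, Lemmas 6.15, 6.16, 6.18] [cite: Jetchev2008, Cor. 1.5] -/
theorem Three.cornerInertAdmissibleAnchor_or_upToOne_of_multiCarrier_of_shape
    (W : WeierstrassCurve ℚ) [W.IsElliptic] [W.IsGloballyMinimal] (hX : ClassX11b W 3)
    (hmulti : ∀ v : HeightOneSpectrum (𝓞 ℚ), padicValNat 3 (W.tamagawaNumberAt v) < padicValNat 3 W.tamagawaProduct)
    (hshape : ∀ (q : ℕ) [Fact q.Prime], 3 ∣ (W.baseChange ℚ_[q]).localTamagawaNumber ℤ_[q] →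
      W.HasSplitMultiplicativeReductionAtPrime q) :
    Three.CornerInertAdmissibleAnchor W ∨ Three.CornerInertAdmissibleUpToOneAnchor W := by
  haveI : Fact (Nat.Prime 3) := ⟨Nat.prime_three⟩
  have hmult : Mult W 3 := hX.2.2.1
  have hN0 : W.conductorNorm ℤ ≠ 0 := Nat.pos_iff_ne_zero.mp (WeierstrassCurve.conductorNorm_pos_holds (W := W))
  have h3good : ¬ 3 ∣ 3 - 1 := by decide
  -- the offenders `≠ 3`
  set POff : ℕ → Prop := fun q ↦ ∃ _ : Fact q.Prime, q ≠ 3 ∧ W.HasSplitMultiplicativeReductionAtPrime q ∧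
    3 ∣ padicValInt q W.minimalDiscriminantInt with hPOff
  set Off : Finset ℕ := (W.conductorNorm ℤ).primeFactors.filter POff with hOffdef
  have memOff : ∀ q : ℕ, q ∈ Off ↔ POff q := by
    intro q
    simp only [hOffdef, Finset.mem_filter, Nat.mem_primeFactors]
    refine ⟨fun h ↦ h.2, fun h ↦ ⟨?_, h⟩⟩
    obtain ⟨hF, -, hs, -⟩ := h
    exact ⟨hF.out, dvd_conductorNorm_of_mult hs.hasMultiplicativeReductionAtPrime, hN0⟩
  have h3Off : 3 ∉ Off := fun h ↦ ((memOff 3).mp h).2.1 rfl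
  -- an offender exists
  obtain ⟨ℓ, hℓF, hℓ3, hℓs, hℓd⟩ := Three.exists_splitOffender_ne_three_of_multiCarrier_of_shape W hmulti hshape
  have hℓOff : ℓ ∈ Off := (memOff ℓ).mpr ⟨hℓF, hℓ3, hℓs, hℓd⟩
  -- bookkeeping for `insert 3 X`, `X ⊆ Off`
  have multOf : ∀ X : Finset ℕ, X ⊆ Off → ∀ q ∈ insert 3 X, ∃ _ : Fact q.Prime, Mult W q := by
    intro X hX' q hq
    rcases Finset.mem_insert.mp hq with rfl | hq
    · exact ⟨inferInstance, hmult⟩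
    · obtain ⟨hF, -, hs, -⟩ := (memOff q).mp (hX' hq)
      exact ⟨hF, hs.hasMultiplicativeReductionAtPrime⟩
  have fcOf : ∀ (q : ℕ) [Fact q.Prime], q ∉ insert 3 Off → W.HasSplitMultiplicativeReductionAtPrime q →
      ¬ 3 ∣ padicValInt q W.minimalDiscriminantInt := by
    intro q _ hq hs hd
    rcases eq_or_ne q 3 with rfl | hq3
    · exact hq (Finset.mem_insert_self _ _)
    · exact hq (Finset.mem_insert_of_mem ((memOff q).mpr ⟨inferInstance, hq3, hs, hd⟩))
  rcases Nat.even_or_odd Off.card with hev | hodd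
  · by_cases hspare : ∃ (m : ℕ) (_ : Fact m.Prime), Mult W m ∧ m ≠ 3 ∧ m ∉ Off
    · -- a spare multiplicative prime fixes the parity: `S = {3, m} ∪ Off`
      obtain ⟨m, hmF, hmm, hm3, hmOff⟩ := hspare
      have h3m : (3 : ℕ) ∉ insert m Off := by
        rw [Finset.mem_insert]
        rintro (h | h)
        · exact hm3 h.symm
        · exact h3Off h
      refine Or.inl ⟨hshape, insert 3 (insert m Off), ?_, ?_, ?_,
        Or.inr ⟨3, Finset.mem_insert_self _ _, Or.inr (Or.inl h3good)⟩⟩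
      · intro q hq
        rcases Finset.mem_insert.mp hq with rfl | hq
        · exact ⟨inferInstance, hmult⟩
        rcases Finset.mem_insert.mp hq with rfl | hq
        · exact ⟨hmF, hmm⟩
        · exact multOf Off le_rfl q (Finset.mem_insert_of_mem hq)
      · rw [Finset.card_insert_of_notMem h3m, Finset.card_insert_of_notMem hmOff]
        obtain ⟨n, hn⟩ := hev
        exact ⟨n + 1, by omega⟩
      · intro q _ hq hs
        refine fcOf q (fun h ↦ hq ?_) hs
        rcases Finset.mem_insert.mp h with rfl | h
        · exact Finset.mem_insert_self _ _
        · exact Finset.mem_insert_of_mem (Finset.mem_insert_of_mem h)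
    · -- no spare prime: exempt one offender `ℓ` (the up-to-one road)
      have h3E : (3 : ℕ) ∉ Off.erase ℓ := fun h ↦ h3Off (Finset.mem_of_mem_erase h)
      refine Or.inr ⟨ℓ, hℓF, ?_, fun q _ _ hq ↦ hshape q hq, insert 3 (Off.erase ℓ), ?_, ?_,
        Finset.mem_insert_self _ _, ?_, ?_⟩
      · exact WeierstrassCurve.HasMultiplicativeReduction.not_hasGoodReduction (R := ℤ_[ℓ])
          hℓs.hasMultiplicativeReductionAtPrime
      · exact multOf (Off.erase ℓ) (Finset.erase_subset _ _)
      · rw [Finset.card_insert_of_notMem h3E, Finset.card_erase_of_mem hℓOff]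
        obtain ⟨n, hn⟩ := hev
        have : 0 < Off.card := Finset.card_pos.mpr ⟨ℓ, hℓOff⟩
        exact ⟨n, by omega⟩
      · rw [Finset.mem_insert, Finset.mem_erase, not_or, not_and]
        exact ⟨hℓ3, fun h _ ↦ h rfl⟩
      · intro q _ hq hqℓ hs hd
        rcases eq_or_ne q 3 with rfl | hq3
        · exact hq (Finset.mem_insert_self _ _)
        · exact hq (Finset.mem_insert_of_mem (Finset.mem_erase.mpr
            ⟨hqℓ, (memOff q).mpr ⟨inferInstance, hq3, hs, hd⟩⟩))
  · -- `#Off` odd: `S = {3} ∪ Off`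
    refine Or.inl ⟨hshape, insert 3 Off, multOf Off le_rfl, ?_, fcOf,
      Or.inr ⟨3, Finset.mem_insert_self _ _, Or.inr (Or.inl h3good)⟩⟩
    rw [Finset.card_insert_of_notMem h3Off]
    obtain ⟨n, hn⟩ := hodd
    exact ⟨n + 1, by omega⟩

/-- **THE SHAPE OF THE IMC-GRADE TAIL after r14.** On a multi-carrier (T4″)₃ corner curve (`ClassX11b W 3`) admissible-anchor NEITHER as it stands NOR up to one
exempted place, the Tamagawa shape FAILS: some prime `q` with `3 ∣ c_q(E)` is NOT split multiplicative — on the corner an ADDITIVE prime of Kodaira type IV ∕ IV*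
(`c_q = 3`; non-split multiplicative primes have `c ≤ 2`). This is exactly where r14's `stub_upper3_residualMulti` conjunct 2 (`Three.CornerCoStepLAt W`) is consumed.
Census below `5·10⁵`: empty (lane B g6); class-wide: not empty. Pure logic from the tail lemma; nothing asserted about BSD.
[cite: SilvermanATAEC1994, Cor. IV.9.2 (d) and Table 4.1] [cite: Jetchev2008, Cor. 1.5] -/
theorem Three.cornerTailAnchor_shape (W : WeierstrassCurve ℚ) [W.IsElliptic] [W.IsGloballyMinimal] (hX : ClassX11b W 3)
    (hmulti : ∀ v : HeightOneSpectrum (𝓞 ℚ), padicValNat 3 (W.tamagawaNumberAt v) < padicValNat 3 W.tamagawaProduct)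
    (hnadm : ¬ Three.CornerInertAdmissibleAnchor W) (hnadm1 : ¬ Three.CornerInertAdmissibleUpToOneAnchor W) :
    ∃ (q : ℕ) (_ : Fact q.Prime), 3 ∣ (W.baseChange ℚ_[q]).localTamagawaNumber ℤ_[q] ∧
      ¬ W.HasSplitMultiplicativeReductionAtPrime q := by
  by_contra hsh
  have hshape : ∀ (q : ℕ) [Fact q.Prime], 3 ∣ (W.baseChange ℚ_[q]).localTamagawaNumber ℤ_[q] →
      W.HasSplitMultiplicativeReductionAtPrime q := by
    intro q hqF hq
    by_contra hns
    exact hsh ⟨q, hqF, hq, hns⟩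
  rcases Three.cornerInertAdmissibleAnchor_or_upToOne_of_multiCarrier_of_shape W hX hmulti hshape with hA | hU
  · exact hnadm hA
  · exact hnadm1 hU

end Summit.BirchSwinnertonDyer.BirchSwinnertonDyer.Theorems

end
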